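import Mathlib
import Literature.MathematicalPhysics.QuantumLattice.FinDimSpectrum
import Literature.MathematicalPhysics.QuantumLattice.HubbardModel
import Literature.MathematicalPhysics.QuantumLattice.PairCorrelations
import Summits.HubbardSuperconductivity.Statement

/-!
# Sketch — crux-ideate for `TwTipContinuation` (stmt-HubbardSuperconductivity-1700), ideator k=1, round 1

First lemmas of the two idea cards (`Ideas/ground-space-second-moment.md`,
`Ideas/frame-gauge-projected-moments.md`) stated over existing declarations. Nothing is proved here;
every `def … : Prop` must elaborate (lean check rc 0, 2026-08-15).
-/

noncomputable section

open Literature.MathematicalPhysics.QuantumLattice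
open scoped ComplexOrder Matrix

namespace Summit.HubbardSuperconductivity.HubbardSuperconductivity.Cruxes.TwTipContinuation

/-! ## Card 1 — ground-space second moment -/

/-- FIRST LEMMA of card `ground-space-second-moment` (pure linear algebra, provable now):
Chebyshev on a subspace. For a positive semidefinite `X`, an orthonormal family `e₁ … e_d` and any
unit vector `ψ` in its span, `⟨ψ, X ψ⟩ ≥ A₁ − √(d (A₂ − A₁²))` where `A₁ = d⁻¹ Σ ⟨eᵢ, X eᵢ⟩` and
`A₂ = d⁻¹ Σ ⟨eᵢ, X² eᵢ⟩` (compress `X` to the span: `Y = ΠXΠ`, `λ_min(Y) ≥ ȳ − √(d·var)`,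
`d⁻¹ tr Y² ≤ A₂` because `Π X Π X Π ≤ Π X² Π`). -/
def SecondMomentPinning : Prop :=
  ∀ (m : Type) [Fintype m] [DecidableEq m] (d : ℕ) (X : Matrix m m ℂ) (e : Fin d → m → ℂ)
    (ψ : m → ℂ),
    X.PosSemidef → 0 < d →
    (∀ i j, star (e i) ⬝ᵥ e j = if i = j then (1 : ℂ) else 0) →
    ψ ∈ Submodule.span ℂ (Set.range e) → star ψ ⬝ᵥ ψ = 1 →
    (∑ i, (star (e i) ⬝ᵥ (X *ᵥ e i)).re) / d
        - Real.sqrt (d * ((∑ i, (star (e i) ⬝ᵥ ((X * X) *ᵥ e i)).re) / d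
            - ((∑ i, (star (e i) ⬝ᵥ (X *ᵥ e i)).re) / d) ^ 2))
      ≤ (star ψ ⬝ᵥ (X *ᵥ ψ)).re

/-- `P_L = pairFieldᴴ pairField = 2 Δ_d† Δ_d`, the crux's order operator. -/
abbrev dPairSq (L : ℕ) [NeZero L] :
    Matrix (Finset (Orb (FermionTorus 2 L))) (Finset (Orb (FermionTorus 2 L))) ℂ :=
  (pairField dWaveFormFactor L)ᴴ * pairField dWaveFormFactor L

/-- The ground eigenspace of the pure Hubbard torus INSIDE the `(N, S^z = 0)` sector. -/
def sectorGroundSpace (L : ℕ) (U : ℝ) (N : ℕ) : Submodule ℂ (Fock (Orb (FermionTorus 2 L))) :=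
  szSector (Λ := FermionTorus 2 L) N 0 ⊓
    Module.End.eigenspace (Matrix.toLin' (hubbardTorus 2 L 1 U))
      ((((hubbardTorus 2 L 1 U).minEnergyOn (szSector (Λ := FermionTorus 2 L) N 0) : ℝ) : ℂ))

/-- STUB T1 (ground-space AVERAGE d-wave LRO of the pure model at `(U, δ)`; the `β → ∞`-then-`L → ∞`
tracial ground functional restricted to the sector; NOT an every-ground-state statement). -/
def GsAverageDWaveLRO (U δ a : ℝ) : Prop :=
  ∃ L₀ : ℕ, ∀ (L : ℕ) [NeZero L], L₀ ≤ L → Even L →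
    ∀ (d : ℕ) (e : Fin d → Fock (Orb (FermionTorus 2 L))), 0 < d →
      (∀ i j, star (e i) ⬝ᵥ e j = if i = j then (1 : ℂ) else 0) →
      Submodule.span ℂ (Set.range e) = sectorGroundSpace L U (2 * ⌊(1 - δ) * (L : ℝ) ^ 2 / 2⌋₊) →
      a ≤ (∑ i, (expect (dPairSq L) (e i)).re) / d / (L : ℝ) ^ 4

/-- STUB T2 (ground-space SPREAD of the order: second minus squared first tracial ground moment of
`P_L / L⁴` is `≤ ε L`; physically `ε L ≍ log L / L²`). -/
def GsSecondMomentSpread (U δ : ℝ) (ε : ℕ → ℝ) : Prop :=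
  ∃ L₀ : ℕ, ∀ (L : ℕ) [NeZero L], L₀ ≤ L → Even L →
    ∀ (d : ℕ) (e : Fin d → Fock (Orb (FermionTorus 2 L))), 0 < d →
      (∀ i j, star (e i) ⬝ᵥ e j = if i = j then (1 : ℂ) else 0) →
      Submodule.span ℂ (Set.range e) = sectorGroundSpace L U (2 * ⌊(1 - δ) * (L : ℝ) ^ 2 / 2⌋₊) →
      (∑ i, (expect (dPairSq L * dPairSq L) (e i)).re) / d / (L : ℝ) ^ 8
          - ((∑ i, (expect (dPairSq L) (e i)).re) / d / (L : ℝ) ^ 4) ^ 2 ≤ ε L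

/-- STUB T3 (bounded ground degeneracy in the summit's sector, eventually in even `L`; a spectral
bet that says nothing about order). -/
def BoundedGroundDegeneracy (U δ : ℝ) (D : ℕ) : Prop :=
  ∃ L₀ : ℕ, ∀ (L : ℕ) [NeZero L], L₀ ≤ L → Even L →
    ∀ (d : ℕ) (e : Fin d → Fock (Orb (FermionTorus 2 L))),
      (∀ i, IsGroundStateInSector (hubbardTorus 2 L 1 U) (2 * ⌊(1 - δ) * (L : ℝ) ^ 2 / 2⌋₊) 0 (e i)) →
      (∀ i j, star (e i) ⬝ᵥ e j = if i = j then (1 : ℂ) else 0) → d ≤ D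

/-- The endpoint of the tip in RUNG shape at `g = 0`: EVERY sector ground state of the pure model has
`⟨P_L⟩ ≥ a L⁴` (this is `SummitAt (U, δ)` up to the even-side liminf bookkeeping already in
`Theorems/WeakCouplingBCSWcbcsThesis.lean`). -/
def EveryGsDWaveOrder (U δ a : ℝ) : Prop :=
  ∃ L₀ : ℕ, ∀ (L : ℕ) [NeZero L], L₀ ≤ L → Even L →
    ∀ ψ : Fock (Orb (FermionTorus 2 L)), star ψ ⬝ᵥ ψ = 1 →
      IsGroundStateInSector (hubbardTorus 2 L 1 U) (2 * ⌊(1 - δ) * (L : ℝ) ^ 2 / 2⌋₊) 0 ψ →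
      a * (L : ℝ) ^ 4 ≤ (expect (dPairSq L) ψ).re

/-- COMPOSITION (provable now from `SecondMomentPinning` + an orthonormal basis of
`sectorGroundSpace`): the three stubs give every-ground-state order `a/2`, for EACH `U`; applied to
all `U ≤ U₁` at one `δ` this is the conclusion of `TwTipContinuation`. -/
def PinningComposition : Prop :=
  ∀ (U δ a : ℝ) (D : ℕ) (ε : ℕ → ℝ), 0 < a →
    GsAverageDWaveLRO U δ a → GsSecondMomentSpread U δ ε → BoundedGroundDegeneracy U δ D →
    (∃ L₁ : ℕ, ∀ L : ℕ, L₁ ≤ L → (D : ℝ) * ε L ≤ (a / 2) ^ 2) →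
    EveryGsDWaveOrder U δ (a / 2)

/-! ## Card 1, one-temperature form — weighted Chebyshev -/

/-- FIRST LEMMA (b) of card `ground-space-second-moment` (provable now): weighted Chebyshev on a
subspace. If a density matrix `ρ` is supported on `W = span e` and dominates `w · Π_W` there, then
every unit `ψ ∈ W` has `⟨ψ, X ψ⟩ ≥ tr(ρX) − √((tr(ρX²) − tr(ρX)²)/w)`. With `ρ = Π_W / d` this is
`SecondMomentPinning`; with `ρ` the window-truncated sector Gibbs state at ONE inverse temperature
`β_L` it turns two thermal moments into an every-ground-state bound. -/
def WeightedSecondMomentPinning : Prop :=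
  ∀ (m : Type) [Fintype m] [DecidableEq m] (d : ℕ) (X ρ : Matrix m m ℂ) (e : Fin d → m → ℂ)
    (ψ : m → ℂ) (w : ℝ),
    X.PosSemidef → ρ.PosSemidef → 0 < w → ρ.trace = 1 →
    (∀ i j, star (e i) ⬝ᵥ e j = if i = j then (1 : ℂ) else 0) →
    (∑ i, Matrix.vecMulVec (e i) (star (e i))) * ρ * (∑ i, Matrix.vecMulVec (e i) (star (e i))) = ρ →
    (ρ - (w : ℂ) • ∑ i, Matrix.vecMulVec (e i) (star (e i))).PosSemidef →
    ψ ∈ Submodule.span ℂ (Set.range e) → star ψ ⬝ᵥ ψ = 1 →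
    (ρ * X).trace.re - Real.sqrt (((ρ * X * X).trace.re - ((ρ * X).trace.re) ^ 2) / w)
      ≤ (star ψ ⬝ᵥ (X *ᵥ ψ)).re

/-! ## Card 2 — frame-gauge projected moments -/

/-- FIRST LEMMA of card `frame-gauge-projected-moments` (provable now from the CAR): the pair field
carries charge `−2`, `[N̂, pairField] = −2 · pairField`. Exponentiated, `e^{iφN̂} pairField e^{−iφN̂}
= e^{−2iφ} pairField`: conjugating a d-wave BdG counterterm frame by the number phase ROTATES the
frame, so (i) U(1)-invariant moments `P_L`, `P_L²` are frame independent and (ii) the exact Fourier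
number projection turns into a sum over rotated frames (twisted quasi-free traces). -/
def PairFieldChargeTwo : Prop :=
  ∀ (L : ℕ) [NeZero L],
    (totalNumber : Matrix (Finset (Orb (FermionTorus 2 L))) (Finset (Orb (FermionTorus 2 L))) ℂ) *
        pairField dWaveFormFactor L -
      pairField dWaveFormFactor L * totalNumber = (-2 : ℂ) • pairField dWaveFormFactor L

/-- Consequence used by the card (provable now): `P_L = pairFieldᴴ pairField` commutes with `N̂`
(and, being a spin singlet built from `c_{x↑}c_{y↓} − c_{x↓}c_{y↑}`, with `S^z`), so its sector
moments are moments of the SYMMETRIC sector Gibbs state — no symmetry-breaking selection enters. -/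
def PairSqCommutesNumber : Prop :=
  ∀ (L : ℕ) [NeZero L],
    (totalNumber : Matrix (Finset (Orb (FermionTorus 2 L))) (Finset (Orb (FermionTorus 2 L))) ℂ) *
        dPairSq L = dPairSq L * totalNumber

/-- STUB E1 of card `frame-gauge-projected-moments` (the constructive load, one temperature): sector
thermal d-wave order at the mesoscopic inverse temperature `β_L` — for all large even `L`, the Gibbs
state of the pure torus RESTRICTED to `szSector N_L 0` at `β = b · L / a` has `⟨P_L⟩ ≥ a L⁴`.
Stated through ground states + Boltzmann weights would need the sector-compressed exponential; here
we state the β = ∞ shadow it must in particular imply (T1 of card 1) and keep the thermal form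
informal. -/
def SectorThermalOrderShadow (U δ a : ℝ) : Prop := GsAverageDWaveLRO U δ a

end Summit.HubbardSuperconductivity.HubbardSuperconductivity.Cruxes.TwTipContinuation

end
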